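import Summits.AtomisticToContinuum.Crystallization.Theorems.FrustratedLawDichotomyGSCVanHoveBalls
import Literature.MathematicalPhysics.StatisticalMechanics.CrystallizationLocalLimit

/-!
# FrustratedLawDichotomy · crux `AperiodicFrustratedLawGap` (stmt-AtomisticToContinuum-27623) — THE CHEMICAL POTENTIAL OF AN EXACT μ-EQUILIBRIUM
# WITH VAN HOVE ENERGY DENSITY `μ` IS `e⋆` (exactness of the self-consistent cut; decomp-a2c, prover hand 2, structural share, generation 6)

`FrustratedLawDichotomyGSCSelfConsistentDoor` restates the law-free residual of item 27623 WITHOUT `e⋆`: no textured aperiodic configuration is a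
μ-ground-state configuration of Lennard-Jones at a chemical potential `μc` equal to the energy density of its own root-centred balls.  This module
shows that the restatement loses NOTHING along van Hove balls: for a `δ`-separated configuration `X ⊆ ℝ³` that is a `μc`-GSC of `V_LJ`,

* `eStar_le_mu_of_isMuGSC`    : if `X` has a van Hove family of clusters (e.g. the root-centred balls of
  `FrustratedLawDichotomyGSCVanHoveBalls.exists_vanHove_balls`), then `e⋆ ≤ μc` — NO μ-EQUILIBRIUM BELOW `e⋆` (removal floor against periodisation);
* `mu_le_eStar_of_vanHove_density` : if along root-centred van Hove balls `C_j = X ∩ B̄(0, r_j)` (`r_j → ∞`, `I(C_j, X∖C_j)/n_j → 0`) the energy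
  per atom tends to `μc`, then `μc ≤ e⋆`: otherwise replace `C_j` by a LARGE BLOCK of a periodic configuration `Q` with `e(Q) < μc`
  (`ChargedEnergyGapNegative.Blocks.exists_block_energy_le`, blocks fit in `B̄(0, A·K + B)`, `exists_bpt_norm_le`) — the surgery gains
  `≈ k·(μc − e(Q)) ≫` the `o(n_j)` slack of the removal, since `k/n_j` is bounded below by packing (`card_ball_le`);
* `mu_eq_eStar_of_vanHove_density` : hence `μc = e⋆` — ZERO-PRESSURE μ-EQUILIBRIA OF LENNARD-JONES SIT EXACTLY AT `μ = e⋆`.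

Consequence (by name, in `FrustratedLawDichotomyGSCSelfConsistentDoorExact`): the `e⋆`-free residual in its van Hove form is EQUIVALENT to
`R_GSC^aper`.  All `[folklore]`.
-/

noncomputable section

namespace Summit.AtomisticToContinuum.Crystallization.Theorems.FrustratedLawDichotomyGSCChemicalPotential

open Filter Topology Metric
open Literature.MathematicalPhysics.StatisticalMechanics
open Summit.AtomisticToContinuum.Crystallization.Theorems.ChargedEnergyGapNegative (E3 eStar eStar_le)
open Summit.AtomisticToContinuum.Crystallization.Theorems.ChargedEnergyGapNegative.Blocks
  (BIdx bpt bpt_mem blockConfig blockConfig_apply blockConfig_injective card_BIdx exists_block_energy_le latVec latVecL zBasis coords)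
open Summit.AtomisticToContinuum.Crystallization.Theorems.FrustratedLawDichotomyGSCClusterExactness (cross_le_of_isMuGSC)
open Summit.AtomisticToContinuum.Crystallization.Theorems.FrustratedLawDichotomyGSCVanHoveBalls (abs_tsum_field_le_of_far)

variable {δ : ℝ} {X : Set E3}

/-! ## §1. No μ-equilibrium below `e⋆` -/

/-- **`e⋆ ≤ μ`**: a `μc`-GSC of `V_LJ` admitting a family of finite clusters whose cross-interaction per atom tends to `0` (van Hove family) has
`e⋆ ≤ μc` — since `I(C, X∖C) ≤ (μc − e⋆)·n` for every cluster (`cross_le_of_isMuGSC`). [folklore] -/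
theorem eStar_le_mu_of_isMuGSC {μc : ℝ} (h : IsMuGSC lennardJones μc X) {ι : Type*} {l : Filter ι} [l.NeBot]
    (n : ι → ℕ) (xf : ∀ j, Fin (n j) → E3) (hinj : ∀ j, Function.Injective (xf j)) (hX : ∀ j, Set.range (xf j) ⊆ X)
    (hnpos : ∀ j, 0 < n j)
    (hI : Tendsto (fun j => (∑ i, ∑' y : ↥(X \ Set.range (xf j)), lennardJones (dist (xf j i) y)) / (n j : ℝ)) l (𝓝 0)) :
    eStar ≤ μc := by
  have hbound : ∀ j, (∑ i, ∑' y : ↥(X \ Set.range (xf j)), lennardJones (dist (xf j i) y)) / (n j : ℝ) ≤ μc - eStar := fun j => by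
    have hnj : (0 : ℝ) < n j := by exact_mod_cast hnpos j
    rw [div_le_iff₀ hnj]
    exact cross_le_of_isMuGSC h (hinj j) (hX j)
  have h0 : (0 : ℝ) ≤ μc - eStar := le_of_tendsto' hI hbound
  linarith

/-- **Rooted separated μ-equilibria have `μ ≥ e⋆`** (the van Hove balls of `exists_vanHove_balls` supply the family). [folklore] -/
theorem eStar_le_mu_of_isMuGSC_rooted (hδ : 0 < δ) (hsep : ∀ a ∈ X, ∀ b ∈ X, a ≠ b → δ ≤ dist a b) (h0 : (0 : E3) ∈ X)
    {μc : ℝ} (h : IsMuGSC lennardJones μc X) : eStar ≤ μc := by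
  obtain ⟨r, n, xf, -, hinj, hrange, hnpos, hI⟩ :=
    FrustratedLawDichotomyGSCVanHoveBalls.exists_vanHove_balls hδ hsep h0
  exact eStar_le_mu_of_isMuGSC h n xf hinj (fun j => (hrange j).le.trans Set.inter_subset_left) hnpos hI

/-! ## §2. Geometry: packing of balls, size of periodic blocks -/

/-- **Packing**: a root-centred ball cluster of a `δ`-separated `X` has at most `(2r/δ + 1)³` atoms. [folklore] -/
theorem card_ball_le (hδ : 0 < δ) (hsep : ∀ a ∈ X, ∀ b ∈ X, a ≠ b → δ ≤ dist a b) {r : ℝ} (hr : 0 ≤ r)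
    {n : ℕ} {xf : Fin n → E3} (hinj : Function.Injective xf) (hrange : Set.range xf = X ∩ closedBall 0 r) :
    (n : ℝ) ≤ (2 * r / δ + 1) ^ 3 := by
  classical
  have hmem : ∀ c ∈ Finset.univ.image xf, c ∈ X ∩ closedBall (0 : E3) r := fun c hc => by
    obtain ⟨i, -, rfl⟩ := Finset.mem_image.1 hc
    exact hrange ▸ Set.mem_range_self i
  have h := card_le_of_separated_of_dist_le (Finset.univ.image xf) (0 : E3) hδ hr
    (fun c hc => mem_closedBall.1 (hmem c hc).2) (fun c hc d hd hcd => hsep c (hmem c hc).1 d (hmem d hd).1 hcd)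
  rw [Finset.card_image_of_injective _ hinj, Finset.card_univ, Fintype.card_fin] at h
  simpa [finrank_euclideanSpace_fin] using h

/-- **Blocks fit in balls**: for a periodic configuration `Q` there are `A, B ≥ 0` with `‖bpt Q K u‖ ≤ A·K + B` for every block point
(`K³` cells, any `K`). [folklore] -/
theorem exists_bpt_norm_le (Q : PeriodicConfiguration 3) :
    ∃ A B : ℝ, 0 ≤ A ∧ 0 ≤ B ∧ ∀ (K : ℕ) (u : BIdx Q K), ‖bpt Q K u‖ ≤ A * K + B := by
  refine ⟨∑ i, ‖((zBasis Q i : Q.lattice) : E3)‖, ∑ x ∈ Q.motif, ‖x‖, by positivity, by positivity, fun K u => ?_⟩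
  have h1 : ‖((u.1 : Q.motif) : E3)‖ ≤ ∑ x ∈ Q.motif, ‖x‖ :=
    Finset.single_le_sum (f := fun x => ‖x‖) (fun _ _ => norm_nonneg _) u.1.2
  have hlat : latVec Q (coords K u.2) = ∑ i, ((coords K u.2 i : ℤ) : ℝ) • ((zBasis Q i : Q.lattice) : E3) := by
    show ((latVecL Q (coords K u.2) : Q.lattice) : E3) = _
    unfold latVecL
    rw [Module.Basis.equivFun_symm_apply, Submodule.coe_sum]
    refine Finset.sum_congr rfl fun i _ => ?_
    rw [Submodule.coe_smul_of_tower, Int.cast_smul_eq_zsmul]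
  have hcoord : ∀ i, |((coords K u.2 i : ℤ) : ℝ)| ≤ K := fun i => by
    have h0 : (0 : ℝ) ≤ ((coords K u.2 i : ℤ) : ℝ) := by simp [coords]
    rw [abs_of_nonneg h0]
    have : ((u.2 i : ℕ) : ℝ) < K := by exact_mod_cast (u.2 i).isLt
    simp only [coords, Int.cast_natCast]
    exact this.le
  have h2 : ‖latVec Q (coords K u.2)‖ ≤ (∑ i, ‖((zBasis Q i : Q.lattice) : E3)‖) * K := by
    rw [hlat, Finset.sum_mul]
    refine (norm_sum_le _ _).trans (Finset.sum_le_sum fun i _ => ?_)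
    rw [norm_smul, Real.norm_eq_abs, mul_comm]
    exact mul_le_mul_of_nonneg_left (hcoord i) (norm_nonneg _)
  calc ‖bpt Q K u‖ = ‖((u.1 : Q.motif) : E3) + latVec Q (coords K u.2)‖ := rfl
    _ ≤ ‖((u.1 : Q.motif) : E3)‖ + ‖latVec Q (coords K u.2)‖ := norm_add_le _ _
    _ ≤ (∑ x ∈ Q.motif, ‖x‖) + (∑ i, ‖((zBasis Q i : Q.lattice) : E3)‖) * K := add_le_add h1 h2
    _ = (∑ i, ‖((zBasis Q i : Q.lattice) : E3)‖) * K + ∑ x ∈ Q.motif, ‖x‖ := by ring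

/-! ## §3. No zero-pressure μ-equilibrium above `e⋆` -/

/-- The field of the rest of `X` (outside the ball of radius `r`) at `k` points inside the half ball is at most `k·T(δ, r/2)`. [folklore] -/
theorem sum_field_le_of_inner (hδ : 0 < δ) (hsep : ∀ a ∈ X, ∀ b ∈ X, a ≠ b → δ ≤ dist a b) {r : ℝ} (hδr : δ ≤ r / 2)
    {n : ℕ} {xf : Fin n → E3} (hrange : Set.range xf = X ∩ closedBall 0 r)
    {k : ℕ} (R : Fin k → E3) (hR : ∀ a, ‖R a‖ ≤ r / 2) :
    ∑ a, ∑' y : ↥(X \ Set.range xf), lennardJones (dist (R a) y) ≤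
      (k : ℝ) * ((δ⁻¹ ^ 6 / 12 + 1 / 6) * (1024 / (δ ^ 3 * (r / 2) ^ 3))) := by
  have hsepY : ∀ a ∈ X \ Set.range xf, ∀ b ∈ X \ Set.range xf, a ≠ b → δ ≤ dist a b :=
    fun a ha b hb hab => hsep a ha.1 b hb.1 hab
  have hfar : ∀ a, ∀ y ∈ X \ Set.range xf, r / 2 ≤ dist (R a) y := fun a y hy => by
    have hyr : r < ‖y‖ := by
      by_contra hle
      exact hy.2 (hrange ▸ ⟨hy.1, by rw [mem_closedBall, dist_zero_right]; exact not_lt.1 hle⟩)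
    have h1 : ‖y‖ - ‖R a‖ ≤ dist (R a) y := by
      rw [dist_comm, dist_eq_norm]; exact norm_sub_norm_le y (R a)
    linarith [hR a]
  calc ∑ a, ∑' y : ↥(X \ Set.range xf), lennardJones (dist (R a) y)
      ≤ ∑ a, |∑' y : ↥(X \ Set.range xf), lennardJones (dist (R a) y)| :=
        Finset.sum_le_sum fun a _ => le_abs_self _
    _ ≤ ∑ _a : Fin k, ((δ⁻¹ ^ 6 / 12 + 1 / 6) * (1024 / (δ ^ 3 * (r / 2) ^ 3))) :=
        Finset.sum_le_sum fun a _ => abs_tsum_field_le_of_far hδ hsepY (R a) hδr (hfar a)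
    _ = (k : ℝ) * ((δ⁻¹ ^ 6 / 12 + 1 / 6) * (1024 / (δ ^ 3 * (r / 2) ^ 3))) := by
        rw [Finset.sum_const, Finset.card_univ, Fintype.card_fin, nsmul_eq_mul]

/-- **`μ ≤ e⋆` FOR ZERO-PRESSURE μ-EQUILIBRIA.**  Let `X ⊆ ℝ³` be `δ`-separated and a `μc`-GSC of `V_LJ`, and let `C_j = xf_j(Fin n_j) =
X ∩ B̄(0, r_j)` be root-centred clusters with `r_j → ∞`, cross-interaction per atom `→ 0` and energy per atom `→ μc`.  Then `μc ≤ e⋆`.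
Proof: were `e⋆ < μc`, pick a periodic `Q` with `e(Q) < μc` and replace `C_j` by the block of `K_j³` cells of `Q` (`K_j ≍ r_j`) inside
`B̄(0, r_j/2)`: its energy is `≤ k_j (e(Q) + ε)`, its interaction with the rest `≤ k_j·T(δ, r_j/2)`, while removing `C_j` frees
`≥ (μc − η)·n_j`; since `k_j ≳ n_j` by packing, the surgery balance drops below `μc (k_j − n_j)` — contradicting Sütő's stability. [folklore] -/
theorem mu_le_eStar_of_vanHove_density (hδ : 0 < δ) (hsep : ∀ a ∈ X, ∀ b ∈ X, a ≠ b → δ ≤ dist a b)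
    {μc : ℝ} (h : IsMuGSC lennardJones μc X)
    {r : ℕ → ℝ} {n : ℕ → ℕ} {xf : ∀ j : ℕ, Fin (n j) → E3}
    (hinj : ∀ j, Function.Injective (xf j)) (hrange : ∀ j, Set.range (xf j) = X ∩ closedBall 0 (r j))
    (hnpos : ∀ j, 0 < n j) (hr : Tendsto r atTop atTop)
    (hI : Tendsto (fun j => (∑ i, ∑' y : ↥(X \ Set.range (xf j)), lennardJones (dist (xf j i) y)) / (n j : ℝ)) atTop (𝓝 0))
    (hU : Tendsto (fun j => interactionEnergy lennardJones (xf j) / (n j : ℝ)) atTop (𝓝 μc)) :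
    μc ≤ eStar := by
  classical
  by_contra hlt
  rw [not_le] at hlt
  -- a periodic competitor strictly below `μc`
  obtain ⟨Q, hQ⟩ : ∃ Q : PeriodicConfiguration 3, Q.energyPerParticle lennardJones < μc := exists_lt_of_ciInf_lt hlt
  set g : ℝ := μc - Q.energyPerParticle lennardJones with hg
  have hgpos : 0 < g := by rw [hg]; linarith
  obtain ⟨K₀, -, hblock⟩ := exists_block_energy_le Q (show 0 < g / 4 by positivity)
  obtain ⟨A, B, hA, hB, hbpt⟩ := exists_bpt_norm_le Q
  have hA1 : 0 < A + 1 := by linarith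
  set P : ℝ := (A + 1) ^ 3 with hP
  have hPpos : 0 < P := by positivity
  set m : ℕ := Q.motif.card with hm
  have hmpos : 0 < m := Q.motif_nonempty.card_pos
  have hmr : (0 : ℝ) < m := by exact_mod_cast hmpos
  -- the slack `η`
  set η : ℝ := (m : ℝ) * g * δ ^ 3 / (6912 * P) with hη
  have hηpos : 0 < η := by positivity
  -- block size at scale `j`
  set Kf : ℕ → ℕ := fun j => ⌊(r j / 2 - B) / (A + 1)⌋₊ with hKf
  have hfit : ∀ j, B ≤ r j / 2 → ∀ u : BIdx Q (Kf j), ‖bpt Q (Kf j) u‖ ≤ r j / 2 := fun j hj u => by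
    have hK : ((Kf j : ℕ) : ℝ) ≤ (r j / 2 - B) / (A + 1) := Nat.floor_le (div_nonneg (by linarith) hA1.le)
    have h3 : (A + 1) * (Kf j : ℝ) ≤ r j / 2 - B := by rwa [le_div_iff₀' hA1] at hK
    have hAK : A * (Kf j : ℝ) ≤ (A + 1) * (Kf j : ℝ) := by nlinarith [Nat.cast_nonneg (α := ℝ) (Kf j)]
    linarith [hbpt (Kf j) u]
  have hKlow : ∀ j, 4 * B + 4 * (A + 1) ≤ r j → r j / (4 * (A + 1)) ≤ (Kf j : ℝ) := fun j hj => by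
    have hK : (r j / 2 - B) / (A + 1) - 1 ≤ (Kf j : ℝ) := by
      have := Nat.lt_floor_add_one ((r j / 2 - B) / (A + 1))
      linarith
    have h1 : r j / (4 * (A + 1)) ≤ (r j / 2 - B) / (A + 1) - 1 := by
      rw [div_le_iff₀ (by positivity), sub_mul, div_mul_eq_mul_div, mul_comm (r j / 2 - B) (4 * (A + 1))]
      rw [show 4 * (A + 1) * (r j / 2 - B) / (A + 1) = 4 * (r j / 2 - B) by field_simp]
      linarith
    linarith
  -- eventual conditions
  have ev1 : ∀ᶠ j in atTop, 4 * B + 4 * (A + 1) + 2 * δ ≤ r j := hr.eventually_ge_atTop _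
  have ev2 : ∀ᶠ j in atTop, K₀ ≤ Kf j := by
    have ht : Tendsto (fun j => (r j / 2 - B) / (A + 1)) atTop atTop := by
      refine Tendsto.atTop_div_const hA1 ?_
      have h2 : Tendsto (fun j => r j / 2) atTop atTop := Tendsto.atTop_div_const (by norm_num) hr
      simpa only [sub_eq_add_neg] using tendsto_atTop_add_const_right atTop (-B) h2
    exact (ht.eventually_ge_atTop (K₀ : ℝ)).mono fun j hj => Nat.le_floor hj
  have ev3 : ∀ᶠ j in atTop, (δ⁻¹ ^ 6 / 12 + 1 / 6) * (1024 / (δ ^ 3 * (r j / 2) ^ 3)) ≤ g / 4 := by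
    have hden : Tendsto (fun j => δ ^ 3 * (r j / 2) ^ 3) atTop atTop :=
      ((tendsto_pow_atTop three_ne_zero).comp (Tendsto.atTop_div_const (by norm_num) hr)).const_mul_atTop (by positivity)
    have h2 : Tendsto (fun j => (δ⁻¹ ^ 6 / 12 + 1 / 6) * ((1024 : ℝ) / (δ ^ 3 * (r j / 2) ^ 3))) atTop (𝓝 0) := by
      simpa only [mul_zero] using (tendsto_const_nhds.div_atTop hden).const_mul (δ⁻¹ ^ 6 / 12 + 1 / 6)
    exact h2.eventually_le_const (by positivity)
  have ev4 : ∀ᶠ j in atTop, μc - η ≤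
      (interactionEnergy lennardJones (xf j) + ∑ i, ∑' y : ↥(X \ Set.range (xf j)), lennardJones (dist (xf j i) y)) / (n j : ℝ) := by
    have hsum := hU.add hI
    rw [add_zero] at hsum
    have hsum' : Tendsto (fun j => (interactionEnergy lennardJones (xf j) +
        ∑ i, ∑' y : ↥(X \ Set.range (xf j)), lennardJones (dist (xf j i) y)) / (n j : ℝ)) atTop (𝓝 μc) := by
      refine hsum.congr fun j => ?_
      rw [add_div]
    exact hsum'.eventually_const_le (by linarith)
  obtain ⟨j, hj1, hj2, hj3, hj4⟩ := (ev1.and (ev2.and (ev3.and ev4))).exists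
  have hrδ : δ ≤ r j / 2 := by linarith
  have hrpos : 0 < r j := by linarith
  have hjB : B ≤ r j / 2 := by nlinarith
  have hjAB : 4 * B + 4 * (A + 1) ≤ r j := by linarith
  -- the surgery: remove the ball, insert the block
  set K : ℕ := Kf j with hK
  set k : ℕ := Fintype.card (BIdx Q K) with hk
  have hkval : (k : ℝ) = m * (K : ℝ) ^ 3 := by rw [hk, card_BIdx]; push_cast; rw [hm]
  have hRnorm : ∀ a, ‖blockConfig Q K a‖ ≤ r j / 2 := fun a => by
    rw [blockConfig_apply]; exact hfit j hjB _
  have hdisj : Disjoint (Set.range (blockConfig Q K)) (X \ Set.range (xf j)) := by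
    refine Set.disjoint_left.2 ?_
    rintro _ ⟨a, rfl⟩ hy
    have hyr : r j < ‖blockConfig Q K a‖ := by
      by_contra hle
      exact hy.2 ((hrange j).symm ▸ ⟨hy.1, by rw [mem_closedBall, dist_zero_right]; exact not_lt.1 hle⟩)
    linarith [hRnorm a]
  have key := h.le (hinj j) ((hrange j).le.trans Set.inter_subset_left) (blockConfig_injective Q K) hdisj
  -- bounds on the inserted side
  have hUR : interactionEnergy lennardJones (blockConfig Q K) ≤ (k : ℝ) * (Q.energyPerParticle lennardJones + g / 4) :=
    hblock K hj2
  have hIR : ∑ a, ∑' y : ↥(X \ Set.range (xf j)), lennardJones (dist (blockConfig Q K a) y) ≤ (k : ℝ) * (g / 4) :=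
    (sum_field_le_of_inner hδ hsep hrδ (hrange j) (blockConfig Q K) hRnorm).trans
      (mul_le_mul_of_nonneg_left hj3 (Nat.cast_nonneg k))
  -- bound on the removed side
  have hnj : (0 : ℝ) < n j := by exact_mod_cast hnpos j
  have hL : (μc - η) * (n j : ℝ) ≤ interactionEnergy lennardJones (xf j) +
      ∑ i, ∑' y : ↥(X \ Set.range (xf j)), lennardJones (dist (xf j i) y) := by
    rwa [le_div_iff₀ hnj] at hj4
  -- Sütő's inequality then forces `k·g/2 ≤ η·n`
  have hkn : (k : ℝ) * g / 2 ≤ η * (n j : ℝ) := by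
    have hgk : (k : ℝ) * (Q.energyPerParticle lennardJones + g / 4) + (k : ℝ) * (g / 4) - μc * k = -((k : ℝ) * g / 2) := by
      rw [hg]; ring
    nlinarith [key, hUR, hIR, hL, hgk]
  -- packing: `n ≤ 27 r³/δ³`; block size: `k ≥ m r³ / (64 P)`
  have hn_le : (n j : ℝ) ≤ 27 * r j ^ 3 / δ ^ 3 := by
    have h1 := card_ball_le hδ hsep hrpos.le (hinj j) (hrange j)
    have h2 : 2 * r j / δ + 1 ≤ 3 * r j / δ := by
      rw [div_add_one (ne_of_gt hδ), div_le_div_iff_of_pos_right hδ]; linarith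
    have h3 : (2 * r j / δ + 1) ^ 3 ≤ (3 * r j / δ) ^ 3 := pow_le_pow_left₀ (by positivity) h2 3
    have h4 : (3 * r j / δ) ^ 3 = 27 * r j ^ 3 / δ ^ 3 := by ring
    linarith
  have hk_ge : (m : ℝ) * (r j ^ 3 / (64 * P)) ≤ (k : ℝ) := by
    rw [hkval]
    refine mul_le_mul_of_nonneg_left ?_ hmr.le
    have h1 : r j / (4 * (A + 1)) ≤ (K : ℝ) := hKlow j hjAB
    have h2 : (r j / (4 * (A + 1))) ^ 3 ≤ (K : ℝ) ^ 3 := pow_le_pow_left₀ (by positivity) h1 3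
    have h3 : (r j / (4 * (A + 1))) ^ 3 = r j ^ 3 / (64 * P) := by
      rw [hP, div_pow, mul_pow]; norm_num
    linarith
  -- contradiction
  have hchain : (m : ℝ) * g * r j ^ 3 / (128 * P) ≤ (m : ℝ) * g * r j ^ 3 / (256 * P) := by
    calc (m : ℝ) * g * r j ^ 3 / (128 * P) = ((m : ℝ) * (r j ^ 3 / (64 * P))) * g / 2 := by ring
      _ ≤ (k : ℝ) * g / 2 := by gcongr
      _ ≤ η * (n j : ℝ) := hkn
      _ ≤ η * (27 * r j ^ 3 / δ ^ 3) := mul_le_mul_of_nonneg_left hn_le hηpos.le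
      _ = (m : ℝ) * g * r j ^ 3 / (256 * P) := by rw [hη]; field_simp; ring
  have hposq : 0 < (m : ℝ) * g * r j ^ 3 / (256 * P) := by positivity
  have : (m : ℝ) * g * r j ^ 3 / (128 * P) = 2 * ((m : ℝ) * g * r j ^ 3 / (256 * P)) := by ring
  linarith

/-- **`μ = e⋆` for zero-pressure μ-equilibria**: under the hypotheses of `mu_le_eStar_of_vanHove_density`, `μc = e⋆`. [folklore] -/
theorem mu_eq_eStar_of_vanHove_density (hδ : 0 < δ) (hsep : ∀ a ∈ X, ∀ b ∈ X, a ≠ b → δ ≤ dist a b)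
    {μc : ℝ} (h : IsMuGSC lennardJones μc X)
    {r : ℕ → ℝ} {n : ℕ → ℕ} {xf : ∀ j : ℕ, Fin (n j) → E3}
    (hinj : ∀ j, Function.Injective (xf j)) (hrange : ∀ j, Set.range (xf j) = X ∩ closedBall 0 (r j))
    (hnpos : ∀ j, 0 < n j) (hr : Tendsto r atTop atTop)
    (hI : Tendsto (fun j => (∑ i, ∑' y : ↥(X \ Set.range (xf j)), lennardJones (dist (xf j i) y)) / (n j : ℝ)) atTop (𝓝 0))
    (hU : Tendsto (fun j => interactionEnergy lennardJones (xf j) / (n j : ℝ)) atTop (𝓝 μc)) :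
    μc = eStar :=
  le_antisymm (mu_le_eStar_of_vanHove_density hδ hsep h hinj hrange hnpos hr hI hU)
    (eStar_le_mu_of_isMuGSC h n xf hinj (fun j => (hrange j).le.trans Set.inter_subset_left) hnpos hI)

end Summit.AtomisticToContinuum.Crystallization.Theorems.FrustratedLawDichotomyGSCChemicalPotential

end
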